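import Summits.QuantumAdvantage.QuantumAdvantage.Theorems.LinnikCubicClassGroupsDegreeOnePrimesEscapeSymmetricClosure
import Summits.QuantumAdvantage.QuantumAdvantage.Theorems.LinnikCubicClassGroupsDegreeOnePrimesEscapeOneSidedFrobenius
import HarnessLib

/-!
# One-sided cycle-type classes occur as Frobenius below `|d_K|^L` in generic degree-`n` fields

Topic `Summits/QuantumAdvantage/QuantumAdvantage/Theorems`, cell B2b-1 (linnik-cubic), PART A (gen 8);
helper toward the crux `DegreeOnePrimesEscape` (stmt-QuantumAdvantage-11543) of route
`LinnikCubicClassGroups`.  HONEST FRAMING: the value of this file is a THEOREM (kernel-checked, GRH-free,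
Siegel-free, no hypothesis) — NOT summit progress.

**Theorem** (`exists_frobenius_mem_of_oneSided_symmetric`).  Let `n > 1`, `f₁ > s`, `t`, proper
subgroups `H₁, …, H_s < S_n = Perm (Fin n)` and `C ⊆ S_n` satisfy the ONE-SIDED inequality
`f₁ ≤ Σ_i Ind_{H_i} 1 (y) + t·𝟙[y ∈ C]` for all `y ∈ S_n` (a finite check, e.g. by `decide`).  Then
there is `L > 0` such that every number field `K` of degree `n` all of whose Galois splitting fields
have degree `≥ n!` (the generic, "`S_n`", case) has a prime `p ≤ |d_K|^L`, `p ∤ d_K`, and some `σ ∈ C`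
with

  `Σ_{𝔭 ∣ p in K, f(𝔭|p) ∣ m} f(𝔭|p) = #Fix(σ^m)`   for every `m`

— i.e. the splitting type of `p` in `K` is the cycle type of `σ` (Perlis' dictionary, all `m` at once;
`eq_of_forall_sum_filter_dvd_eq` in the tree recovers the multiset).  Assembled from `symmetricClosure`
(`Gal(N/ℚ) ≃ S_n`, `Gal(N/K) = Stab 0`, `|d_N| ≤ |d_K|^{n!}`), the general one-sided principle
`exists_frobenius_mem_of_oneSided` (only UPPER bounds for the fields `N^{H_i}` and the prime number
theorem), and the unramified dictionary `card_fixingSubgroup_mul_sum_filter_dvd` with the fixed-point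
bookkeeping `card_filter_conj_apply_zero`.  Instances: `n = 4`, `C` = 4-cycles (`…QuarticS4*.lean`,
inert primes); `n = 3`, `C` = transpositions (`exists_partialPrime_le`).  A small LP shows the classes
`(4,1)` and `(3,2)` of `S₅` qualify as well (not the 5-cycles), left to a successor.

References: J. C. Lagarias, H. L. Montgomery, A. M. Odlyzko, Invent. Math. 54 (1979)
[LagariasMontgomeryOdlyzko1979]; R. Perlis, J. Number Theory 9 (1977) [Perlis1977].
-/

noncomputable section

open scoped NumberField nonZeroDivisors
open Finset Real Ideal NumberField
open Literature.NumberTheory.NumberFields Literature.NumberTheory.LFunctions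
  Literature.NumberTheory.LFunctions.NumberField

namespace Summit.QuantumAdvantage.QuantumAdvantage.Theorems.DegreeOnePrimesEscape

section Pullback

variable {n : ℕ} {G : Type*} [Group G] (ψ : G ≃* Equiv.Perm (Fin n))

/-- Conjugation counts of a pulled-back subgroup. -/
theorem natCard_conj_mem_comap (H : Subgroup (Equiv.Perm (Fin n))) (x : G) :
    Nat.card {g : G // g * x * g⁻¹ ∈ H.comap ψ.toMonoidHom} =
      Nat.card {q : Equiv.Perm (Fin n) // q * ψ x * q⁻¹ ∈ H} := by
  refine Nat.card_congr
    { toFun := fun g => ⟨ψ g.1, by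
        have h := g.2
        rw [Subgroup.mem_comap, MulEquiv.coe_toMonoidHom, map_mul, map_mul, map_inv] at h
        exact h⟩
      invFun := fun q => ⟨ψ.symm q.1, by
        rw [Subgroup.mem_comap, MulEquiv.coe_toMonoidHom, map_mul, map_mul, map_inv,
          MulEquiv.apply_symm_apply]; exact q.2⟩
      left_inv := fun g => Subtype.ext (ψ.symm_apply_apply g.1)
      right_inv := fun q => Subtype.ext (ψ.apply_symm_apply q.1) }

/-- The order of a pulled-back subgroup. -/
theorem natCard_comap (H : Subgroup (Equiv.Perm (Fin n))) :
    Nat.card (H.comap ψ.toMonoidHom) = Nat.card H := by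
  refine Nat.card_congr
    { toFun := fun g => ⟨ψ g.1, by
        have h := g.2
        rw [Subgroup.mem_comap, MulEquiv.coe_toMonoidHom] at h
        exact h⟩
      invFun := fun q => ⟨ψ.symm q.1, by
        rw [Subgroup.mem_comap, MulEquiv.coe_toMonoidHom, MulEquiv.apply_symm_apply]; exact q.2⟩
      left_inv := fun g => Subtype.ext (ψ.symm_apply_apply g.1)
      right_inv := fun q => Subtype.ext (ψ.apply_symm_apply q.1) }

/-- A pulled-back proper subgroup is proper. -/
theorem comap_ne_top (H : Subgroup (Equiv.Perm (Fin n))) (hH : H ≠ ⊤) :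
    H.comap ψ.toMonoidHom ≠ ⊤ := by
  intro h
  apply hH
  rw [eq_top_iff]
  intro q _
  have : ψ.symm q ∈ H.comap ψ.toMonoidHom := h ▸ Subgroup.mem_top _
  rw [Subgroup.mem_comap, MulEquiv.coe_toMonoidHom, MulEquiv.apply_symm_apply] at this
  exact this

end Pullback

set_option maxHeartbeats 800000 in
/-- **One-sided cycle-type classes occur below `|d_K|^L` in `S_n`-fields.** See the module docstring.
[cite: LagariasMontgomeryOdlyzko1979, Theorem 1.1] [cite: Perlis1977, §1] -/
theorem exists_frobenius_mem_of_oneSided_symmetric (n s f₁ t : ℕ) [NeZero n] (hn : 1 < n)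
    (hs : s < f₁) (H : Fin s → Subgroup (Equiv.Perm (Fin n))) (hH : ∀ i, H i ≠ ⊤)
    (C : Set (Equiv.Perm (Fin n))) [DecidablePred (· ∈ C)]
    (hpt : ∀ y : Equiv.Perm (Fin n), (f₁ : ℝ) ≤
      ∑ i, (Nat.card {q : Equiv.Perm (Fin n) // q * y * q⁻¹ ∈ H i} : ℝ) / Nat.card (H i) +
        (if y ∈ C then (t : ℝ) else 0)) :
    ∃ L : ℝ, 0 < L ∧ ∀ (K : Type) [Field K] [NumberField K], Module.finrank ℚ K = n →
      (∀ (M : Type) [Field M] [NumberField M] [IsGalois ℚ M],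
        (K →ₐ[ℚ] M) → n.factorial ≤ Module.finrank ℚ M) →
      ∃ p : ℕ, p.Prime ∧ (p : ℝ) ≤ ((NumberField.discr K).natAbs : ℝ) ^ L ∧
        ¬ ((p : ℤ) ∣ NumberField.discr K) ∧
        ∃ σ ∈ C, ∀ m : ℕ, ((splittingType K p).filter (· ∣ m)).sum =
          (Finset.univ.filter fun i : Fin n => (σ ^ m) i = i).card := by
  classical
  have hnf : 1 < n.factorial := lt_of_lt_of_le hn (Nat.self_le_factorial n)
  obtain ⟨L₀, hL₀, hgen⟩ := exists_frobenius_mem_of_oneSided n.factorial s f₁ t hnf hs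
  refine ⟨n.factorial * L₀, by positivity, fun K _ _ hK hSn => ?_⟩
  obtain ⟨N, _, _, hGal, hdeg, K', e, ψ, hstab, hdN⟩ := symmetricClosure n K hK hSn
  haveI := hGal
  -- pull the one-sided data back to `Gal(N/ℚ)`
  set H' : Fin s → Subgroup (N ≃ₐ[ℚ] N) := fun i => (H i).comap ψ.toMonoidHom with hH'
  have hH'ne : ∀ i, H' i ≠ ⊤ := fun i => comap_ne_top ψ (H i) (hH i)
  have hpt' : ∀ x : N ≃ₐ[ℚ] N, (f₁ : ℝ) ≤
      ∑ i, (Nat.card {g : N ≃ₐ[ℚ] N // g * x * g⁻¹ ∈ H' i} : ℝ) / Nat.card (H' i) +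
        (if x ∈ ψ ⁻¹' C then (t : ℝ) else 0) := by
    intro x
    have h := hpt (ψ x)
    simp only [hH', natCard_conj_mem_comap, natCard_comap]
    by_cases hx : ψ x ∈ C
    · rw [if_pos hx] at h
      rw [if_pos (show x ∈ ψ ⁻¹' C from hx)]
      exact h
    · rw [if_neg hx] at h
      rw [if_neg (show x ∉ ψ ⁻¹' C from hx)]
      exact h
  obtain ⟨p, hp, hpx, hpN, Q, hQmax, hQover, φ, hφ, hI, hφC⟩ := hgen N hdeg H' (ψ ⁻¹' C) hH'ne hpt'
  -- sizes
  set d : ℝ := ((NumberField.discr K).natAbs : ℝ) with hd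
  have hd3 : (3 : ℝ) ≤ d := three_le_natAbs_discr_real K (by rw [hK]; exact hn)
  have hd1 : (1 : ℝ) ≤ d := by linarith
  have hpx' : (p : ℝ) ≤ d ^ ((n.factorial : ℝ) * L₀) := by
    have hdNR : ((NumberField.discr N).natAbs : ℝ) ≤ d ^ (n.factorial : ℝ) := by
      rw [Real.rpow_natCast, hd]; exact_mod_cast hdN
    calc (p : ℝ) ≤ ((NumberField.discr N).natAbs : ℝ) ^ L₀ := hpx
      _ ≤ (d ^ (n.factorial : ℝ)) ^ L₀ := Real.rpow_le_rpow (Nat.cast_nonneg _) hdNR hL₀.le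
      _ = d ^ ((n.factorial : ℝ) * L₀) := by rw [← Real.rpow_mul (by linarith)]
  -- `p ∤ d_K`
  have hdisc' : NumberField.discr K' = NumberField.discr K :=
    (NumberField.discr_eq_discr_of_algEquiv K e).symm
  have hdvd : ¬ ((p : ℤ) ∣ NumberField.discr K) := fun h =>
    hpN (h.trans (hdisc' ▸ NumberField.discr_dvd_discr K' N))
  refine ⟨p, hp, by exact_mod_cast hpx', hdvd, ψ φ, hφC, fun m => ?_⟩
  -- the dictionary at `p`: `|Stab 0| · Σ_{f ∣ m} f = c_S(φ^m) = |Stab 0| · #Fix(σ^m)`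
  have hk := card_fixingSubgroup_mul_sum_filter_dvd K' hp Q hφ hI m
  rw [natCard_subgroup_eq_card_filter_perm ψ K'.fixingSubgroup (fun q => q 0 = 0) hstab,
    natCard_conj_mem_eq_card_filter_perm ψ K'.fixingSubgroup (fun q => q 0 = 0) hstab, map_pow,
    card_filter_conj_apply_zero, ← ArithmeticallyEquivalent.of_algEquiv e p hp] at hk
  have hA : 0 < (Finset.univ.filter fun q : Equiv.Perm (Fin n) => q 0 = 0).card :=
    Finset.card_pos.mpr ⟨1, Finset.mem_filter.mpr ⟨Finset.mem_univ _, rfl⟩⟩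
  exact Nat.eq_of_mul_eq_mul_left hA hk

end Summit.QuantumAdvantage.QuantumAdvantage.Theorems.DegreeOnePrimesEscape

end
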